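import Mathlib
import Summits.MatrixMultiplication.Statement
import Summits.MatrixMultiplication.MatrixMultiplication.Theorems.GraphEquationsLowestFormNec
import Summits.MatrixMultiplication.MatrixMultiplication.Theorems.GraphEquationsSquaredSystems

/-!
# ORDER OBSTRUCTION III: the squared (deep) families are LOWEST-FORM NONDEGENERATE — the order
# obstruction is invisible in border rank (`GraphEquations`, M30)

Decomp-mm node «GraphEquations» (lens 5, g36); attacked leaf `MultiplicityReduction`
(stmt-MatrixMultiplication-27806).  Target of the node, VERBATIM: `_root_.MatrixMultiplication`.
Route-neutral (`closes` unchanged); imports no `Theses/` file.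

Kernels M14a/M14b (`GraphEquationsOrderObstruction`, `GraphEquationsSquaredSystems`) refuted
uniform-order purification along a given cheap family: squaring the tests `k` times keeps a system
correct and cheap (`cost ≤ (k+1)·cost`) but puts its tests in `I^(2^k)`, so NO system with tests in
their ideal is pure-isolated / initial-form nondegenerate to any order `K < 2^(k+1)` at any graph
point.  Kernel M28 (`GraphEquationsLowestFormReadOut`, THEOREM D) reads systems off in BORDER rank
from their LOWEST weighted forms with NO order bound.  This module proves that the two meet on the
same systems:

* lowest weighted components are multiplicative (`weightedHomogeneousComponent_mul_of_le`,
  `weightedHomogeneousComponent_pow_of_le`; any weight `w : σ → ℕ`), and the gradient matrix of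
  `P^e` at `γ` is `diag(e·P_o(γ)^{e-1}) · G(γ)` (`gradMatrix_pow`, `rank_gradMatrix_pow`);
* `EqSystem.LowInitUnitAt` — lowest-form nondegenerate at `x` with every `P_o(γ) ≠ 0` (the generator
  systems have it at `0`, `generatorSystem_lowInitUnitAt_zero`); it implies `LowInitNondegAt` and is
  PRESERVED BY SQUARING THE TESTS (`EqSystem.LowInitUnitAt.squareTests`: orders `2^k·m_o`, forms
  `P_o^(2^k)`, same `γ`);
* `exists_deep_lowInitUnit_of_omega_lt` — for every `k` and `β > ω`: cheap correct systems with all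
  tests in `I^(2^k)` which are lowest-form nondegenerate at `0`;
* `deep_family_obstructed_and_served` — **the same systems are (i) NOT `PureIsolatedAt K x` and NOT
  `InitNondegAt K x` for any `K < 2^(k+1)` at any graph point (M14a), yet (ii) served in border rank:
  `bR(⟨n,n,n⟩) ≤ 2·cost` (M28).**

Reading for the crux: in border currency the ORDER of the lowest forms carries no cost at all; what
the order obstruction measures is a defect of the order-`≤ K` currencies (`Purification`,
`EqAdmissibleInit β K`), not of the systems.  The residual behind `MultiplicityReduction` is the
PURITY / non-masking of the lowest forms (`LowInitNondegAt` fails only when a lowest form involves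
`a, b` or the gradient matrix drops rank at every `γ`).  No `sorry`.

Sources: [BurgisserClausenShokrollahi1997, Problem 16.3, (15.1)]; [Strassen1973]; T. Mora,
EUROCAM 1982 (tangent cones) via M14a.
-/

set_option linter.dupNamespace false

noncomputable section

open scoped BigOperators Pointwise

namespace Summit.MatrixMultiplication.MatrixMultiplication.Theorems.GraphEquations

open MvPolynomial
open Literature.Computability.AlgebraicComplexity
open Literature.Computability.AlgebraicComplexity.ArithCircuit

variable {n : ℕ}

/-! ## Lowest weighted components are multiplicative -/

section LowestComponents

variable {σ : Type*} (w : σ → ℕ)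

/-- Weights add on products: if `u` has all weights `≥ m₁` and `v` all weights `≥ m₂`, then `u·v`
has all weights `≥ m₁ + m₂`. -/
theorem weight_ge_of_mem_support_mul {u v : MvPolynomial σ ℂ} {m₁ m₂ : ℕ}
    (hu : ∀ μ ∈ u.support, m₁ ≤ Finsupp.weight w μ) (hv : ∀ μ ∈ v.support, m₂ ≤ Finsupp.weight w μ) :
    ∀ μ ∈ (u * v).support, m₁ + m₂ ≤ Finsupp.weight w μ := by
  classical
  intro μ hμ
  obtain ⟨μ₁, h₁, μ₂, h₂, rfl⟩ := Finset.mem_add.1 (support_mul u v hμ)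
  rw [map_add]
  exact add_le_add (hu μ₁ h₁) (hv μ₂ h₂)

/-- Weights of a power: all weights of `u^e` are `≥ e·m`. -/
theorem weight_ge_of_mem_support_pow {u : MvPolynomial σ ℂ} {m : ℕ}
    (hu : ∀ μ ∈ u.support, m ≤ Finsupp.weight w μ) :
    ∀ e : ℕ, ∀ μ ∈ (u ^ e).support, e * m ≤ Finsupp.weight w μ
  | 0 => fun μ _ => by simp
  | e + 1 => fun μ hμ => by
      rw [pow_succ] at hμ
      have h := weight_ge_of_mem_support_mul w (weight_ge_of_mem_support_pow hu e) hu μ hμ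
      rw [Nat.succ_mul]
      exact h

/-- **Lowest components multiply**: `(u·v)_{m₁+m₂} = u_{m₁} · v_{m₂}` when `u` has weights `≥ m₁`
and `v` weights `≥ m₂` (from the product formula `weightedHomogeneousComponent_mul`). -/
theorem weightedHomogeneousComponent_mul_of_le {u v : MvPolynomial σ ℂ} {m₁ m₂ : ℕ}
    (hu : ∀ μ ∈ u.support, m₁ ≤ Finsupp.weight w μ) (hv : ∀ μ ∈ v.support, m₂ ≤ Finsupp.weight w μ) :
    weightedHomogeneousComponent w (m₁ + m₂) (u * v) =
      weightedHomogeneousComponent w m₁ u * weightedHomogeneousComponent w m₂ v := by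
  classical
  rw [weightedHomogeneousComponent_mul, Finset.sum_eq_single (m₁, m₂)]
  · rintro ⟨i, j⟩ hij hne
    rw [Finset.HasAntidiagonal.mem_antidiagonal] at hij
    rcases Nat.lt_or_ge i m₁ with h1 | h1
    · rw [weightedHomogeneousComponent_eq_zero' i u
        (fun d hd => (lt_of_lt_of_le h1 (hu d hd)).ne'), zero_mul]
    · rcases Nat.lt_or_ge j m₂ with h2 | h2
      · rw [weightedHomogeneousComponent_eq_zero' j v
          (fun d hd => (lt_of_lt_of_le h2 (hv d hd)).ne'), mul_zero]
      · exfalso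
        apply hne
        simp only at hij
        exact Prod.ext (by show i = m₁; omega) (by show j = m₂; omega)
  · intro h
    exact absurd (by simp) h

/-- **Lowest components of powers**: `(u^e)_{e·m} = (u_m)^e` when `u` has weights `≥ m`. -/
theorem weightedHomogeneousComponent_pow_of_le {u : MvPolynomial σ ℂ} {m : ℕ}
    (hu : ∀ μ ∈ u.support, m ≤ Finsupp.weight w μ) :
    ∀ e : ℕ, weightedHomogeneousComponent w (e * m) (u ^ e) = weightedHomogeneousComponent w m u ^ e
  | 0 => by
      rw [pow_zero, pow_zero, zero_mul, weightedHomogeneousComponent_of_mem (isWeightedHomogeneous_one ℂ w)]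
      simp
  | e + 1 => by
      rw [pow_succ, pow_succ, Nat.succ_mul,
        weightedHomogeneousComponent_mul_of_le w (weight_ge_of_mem_support_pow w hu e) hu,
        weightedHomogeneousComponent_pow_of_le hu e]

end LowestComponents

/-! ## The gradient matrix of powers -/

/-- `G(P^e)(γ) = diag(e · P_o(γ)^{e-1}) · G(P)(γ)`. -/
theorem gradMatrix_pow {T : ℕ} (γ : Fin n × Fin n → ℂ) (P : Fin T → MvPolynomial (Fin n × Fin n) ℂ)
    (e : ℕ) :
    gradMatrix γ (fun o => P o ^ e) =
      Matrix.diagonal (fun o => (e : ℂ) * eval γ (P o) ^ (e - 1)) * gradMatrix γ P := by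
  ext o q
  simp only [gradMatrix, Matrix.of_apply, Matrix.diagonal_mul, pderiv_pow, map_mul, map_pow,
    map_natCast]

/-- If `e ≠ 0` and every `P_o(γ) ≠ 0`, the gradient matrix of `P^e` has the rank of that of `P`. -/
theorem rank_gradMatrix_pow {T : ℕ} (γ : Fin n × Fin n → ℂ) (P : Fin T → MvPolynomial (Fin n × Fin n) ℂ)
    {e : ℕ} (he : e ≠ 0) (hP : ∀ o, eval γ (P o) ≠ 0) :
    (gradMatrix γ (fun o => P o ^ e)).rank = (gradMatrix γ P).rank := by
  classical
  rw [gradMatrix_pow]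
  apply Matrix.rank_mul_eq_right_of_isUnit_det
  rw [Matrix.det_diagonal, isUnit_iff_ne_zero, Finset.prod_ne_zero_iff]
  intro o _
  exact mul_ne_zero (Nat.cast_ne_zero.2 he) (pow_ne_zero _ (hP o))

/-! ## Lowest-form nondegenerate with unit forms; stability under squaring -/

namespace EqSystem

/-- `E` is LOWEST-FORM NONDEGENERATE WITH UNIT FORMS at `x`: as `LowInitNondegAt x` (M28), and in
addition every pure lowest form is nonzero at the rank witness `γ`: `P_o(γ) ≠ 0`. -/
def LowInitUnitAt (E : EqSystem n) (x : GraphVars n → ℂ) : Prop :=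
  ∃ (m : Fin E.tests.length → ℕ) (P : Fin E.tests.length → MvPolynomial (Fin n × Fin n) ℂ)
    (γ : Fin n × Fin n → ℂ),
    (∀ o, ∀ μ ∈ (bind₁ (shift x) (E.testPoly (E.tests.get o))).support,
      m o ≤ Finsupp.weight (gw n) μ) ∧
    (∀ o, weightedHomogeneousComponent (gw n) (m o)
        (bind₁ (shift x) (E.testPoly (E.tests.get o))) = aeval (generator n) (P o)) ∧
    (gradMatrix γ P).rank = n * n ∧ ∀ o, eval γ (P o) ≠ 0

/-- Unit forms ⇒ lowest-form nondegenerate. -/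
theorem LowInitUnitAt.lowInitNondegAt {E : EqSystem n} {x : GraphVars n → ℂ} (h : E.LowInitUnitAt x) :
    E.LowInitNondegAt x := by
  obtain ⟨m, P, γ, h1, h2, h3, -⟩ := h
  exact ⟨m, P, γ, h1, h2, h3⟩

/-- **Squaring the tests preserves lowest-form nondegeneracy** (with unit forms): the `k`-fold
squared system has lowest forms `P_o^(2^k)` of orders `2^k · m_o`, same `γ`.  (Stated for systems
whose test list is already trimmed, e.g. the generator systems.) -/
theorem LowInitUnitAt.squareTests {E : EqSystem n} {x : GraphVars n → ℂ} (h : E.LowInitUnitAt x)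
    (htrim : E.trim.tests = E.tests) (k : ℕ) : (E.squareTests k).LowInitUnitAt x := by
  classical
  obtain ⟨m, P, γ, hlow, hinit, hrank, hunit⟩ := h
  have hlen : (E.squareTests k).tests.length = E.tests.length := by
    simp [EqSystem.squareTests, htrim]
  let c : Fin (E.squareTests k).tests.length ≃ Fin E.tests.length := finCongr hlen
  have htest : ∀ o : Fin (E.squareTests k).tests.length,
      (E.squareTests k).testPoly ((E.squareTests k).tests.get o) =
        E.testPoly (E.tests.get (c o)) ^ 2 ^ k := by
    intro o
    have ho : (o : ℕ) < E.trim.tests.length := by rw [htrim, ← hlen]; exact o.2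
    have ho' : (o : ℕ) < E.tests.length := by rw [← hlen]; exact o.2
    rw [List.get_eq_getElem, ← getD_eq_getElem_nat o.2, squareTests_testPoly E k ho, htrim,
      getD_eq_getElem_nat ho', List.get_eq_getElem]
    rfl
  refine ⟨fun o => 2 ^ k * m (c o), fun o => P (c o) ^ 2 ^ k, γ, fun o μ hμ => ?_, fun o => ?_, ?_,
    fun o => ?_⟩
  · rw [htest o, map_pow] at hμ
    exact weight_ge_of_mem_support_pow (gw n) (hlow (c o)) (2 ^ k) μ hμ
  · show weightedHomogeneousComponent (gw n) (2 ^ k * m (c o))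
        (bind₁ (shift x) ((E.squareTests k).testPoly ((E.squareTests k).tests.get o))) =
      aeval (generator n) (P (c o) ^ 2 ^ k)
    rw [htest o, map_pow (bind₁ (shift x)), weightedHomogeneousComponent_pow_of_le (gw n) (hlow (c o)) (2 ^ k),
      hinit, map_pow]
  · have hG : (gradMatrix γ fun o => P (c o) ^ 2 ^ k) =
        (gradMatrix γ fun o => P o ^ 2 ^ k).submatrix c (Equiv.refl _) := by
      ext o q; rfl
    rw [hG, Matrix.rank_submatrix, rank_gradMatrix_pow γ P (pow_ne_zero k two_ne_zero) hunit, hrank]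
  · rw [map_pow]
    exact pow_ne_zero _ (hunit (c o))

end EqSystem

/-! ## The generator systems and their squares -/

section Construction

variable (P : ArithCircuit ℂ (MatMulVars n)) (idx : Fin n × Fin n → ℕ)

/-- The test list of a generator system is already trimmed (indices distinct and in range). -/
theorem generatorSystem_trim_tests :
    (generatorSystem P idx).trim.tests = (generatorSystem P idx).tests := by
  have hnd : (generatorSystem P idx).tests.Nodup := by
    simp only [generatorSystem]
    exact List.nodup_ofFn.2 fun a b h => Fin.ext (by simpa using h)
  have hlt : ∀ j ∈ (generatorSystem P idx).tests, j < (generatorSystem P idx).cost := by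
    intro j hj
    rw [generatorSystem_cost]
    simp only [generatorSystem, List.mem_ofFn] at hj
    obtain ⟨s, rfl⟩ := hj
    have := s.2
    omega
  show ((generatorSystem P idx).tests.filter (· < (generatorSystem P idx).cost)).dedup = _
  rw [List.filter_eq_self.2 (fun j hj => decide_eq_true (hlt j hj)), hnd.dedup]

/-- The generator system is lowest-form nondegenerate WITH UNIT FORMS at `0`: orders `2`, forms
`P_o = F_{q(o)}`, `γ ≡ 1` (gradient = reindexed identity, `F_q(1) = 1`). -/
theorem generatorSystem_lowInitUnitAt_zero (hidx : ∀ p, idx p < P.size)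
    (hval : ∀ p : Fin n × Fin n,
      (gateValues P.gates)[idx p]? = some (genericMatMulEntry ℂ n p.1 p.2)) :
    (generatorSystem P idx).LowInitUnitAt 0 := by
  classical
  let e : Fin (generatorSystem P idx).tests.length ≃ Fin n × Fin n :=
    (finCongr (generatorSystem_tests_length P idx)).trans finProdFinEquiv.symm
  have htest : ∀ o : Fin (generatorSystem P idx).tests.length,
      bind₁ (shift 0) ((generatorSystem P idx).testPoly ((generatorSystem P idx).tests.get o)) =
        generator n (e o) := by
    intro o
    have hs : (generatorSystem P idx).tests.get o =
        P.size + ((Fin.cast (generatorSystem_tests_length P idx) o : Fin (n * n)) : ℕ) := by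
      simp [generatorSystem]
    rw [bind₁_shift_zero, hs, generatorSystem_testPoly P idx hidx hval, rename_genericMatMulEntry]
    rfl
  refine ⟨fun _ => 2, fun o => X (e o), fun _ => 1, fun o μ hμ => ?_, fun o => ?_, ?_, fun o => by simp⟩
  · rw [htest o] at hμ
    exact ((isWeightedHomogeneous_generator (e o)) (mem_support_iff.1 hμ)).symm.le
  · rw [htest o, aeval_X]
    exact weightedHomogeneousComponent_eq_self_of_isWeightedHomogeneous
      (isWeightedHomogeneous_generator (e o))
  · have hG : gradMatrix (fun _ => (1 : ℂ)) (fun o => X (e o)) =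
        (1 : Matrix (Fin n × Fin n) (Fin n × Fin n) ℂ).submatrix e (Equiv.refl _) := by
      ext o q
      simp only [gradMatrix, Matrix.of_apply, Matrix.submatrix_apply, Equiv.coe_refl, pderiv_X]
      by_cases h : e o = q
      · subst h
        rw [id, Matrix.one_apply_eq]; simp
      · simp [h]
    rw [hG, Matrix.rank_submatrix, Matrix.rank_one, Fintype.card_prod, Fintype.card_fin]

end Construction

/-- **Deep AND lowest-form nondegenerate, cheaply, above `ω`.**  For every `k` and every `β > ω`
there are correct systems of cost `O(n^β)` with ALL tests in `I^(2^k)` (the squared generator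
systems of M14b) that are lowest-form nondegenerate with unit forms at the origin. -/
theorem exists_deep_lowInitUnit_of_omega_lt (k : ℕ) {β : ℝ} (hβ : omega ℂ < β) :
    ∃ c : ℝ, ∀ n : ℕ, 1 ≤ n → ∃ E : EqSystem n, E.Correct ∧
      (∀ o : Fin E.tests.length, E.testPoly (E.tests.get o) ∈ graphIdeal n ^ 2 ^ k) ∧
      E.LowInitUnitAt 0 ∧ (E.cost : ℝ) ≤ c * (n : ℝ) ^ β := by
  obtain ⟨C, hC⟩ := BurgisserClausenShokrollahi1997_prop151_holds ℂ (β - omega ℂ) (sub_pos.2 hβ)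
  refine ⟨(k + 1) * (C + 1), fun n hn => ?_⟩
  obtain ⟨P, hP2, hPc, hPs⟩ := hC n hn
  have hex : ∀ p : Fin n × Fin n, ∃ j,
      (gateValues P.gates)[j]? = some (genericMatMulEntry ℂ n p.1 p.2) :=
    fun p => List.mem_iff_getElem?.1 (hPc p.1 p.2)
  choose idx hidx using hex
  have hlt : ∀ p, idx p < P.size := fun p => by
    have := (List.getElem?_eq_some_iff.1 (hidx p)).1
    simpa [ArithCircuit.size] using this
  have hcorr : (generatorSystem P idx).Correct :=
    ⟨generatorSystem_isFanInTwo P idx hP2, generatorSystem_zeroSet P idx hlt hidx⟩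
  refine ⟨(generatorSystem P idx).squareTests k, EqSystem.squareTests_correct hcorr k,
    EqSystem.squareTests_testPoly_mem_pow hcorr k,
    (generatorSystem_lowInitUnitAt_zero P idx hlt hidx).squareTests (generatorSystem_trim_tests P idx) k,
    ?_⟩
  have h1 : (((generatorSystem P idx).squareTests k).cost : ℝ) ≤
      (k + 1) * ((generatorSystem P idx).cost : ℝ) := by
    exact_mod_cast EqSystem.squareTests_cost_le (generatorSystem P idx) k
  have h2 : ((generatorSystem P idx).cost : ℝ) ≤ (C + 1) * (n : ℝ) ^ β := by
    rw [generatorSystem_cost]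
    have hn1 : (1 : ℝ) ≤ n := by exact_mod_cast hn
    have hω2 : (2 : ℝ) ≤ β := (omega_two_le ℂ).trans hβ.le
    have hsq : (n : ℝ) * n ≤ (n : ℝ) ^ β := by
      have h := Real.rpow_le_rpow_of_exponent_le hn1 (show ((2 : ℕ) : ℝ) ≤ β by exact_mod_cast hω2)
      rw [Real.rpow_natCast, sq] at h
      exact h
    have hβeq : omega ℂ + (β - omega ℂ) = β := by ring
    rw [hβeq] at hPs
    push_cast
    linarith
  calc (((generatorSystem P idx).squareTests k).cost : ℝ)
      ≤ (k + 1) * ((generatorSystem P idx).cost : ℝ) := h1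
    _ ≤ (k + 1) * ((C + 1) * (n : ℝ) ^ β) := mul_le_mul_of_nonneg_left h2 (by positivity)
    _ = (k + 1) * (C + 1) * (n : ℝ) ^ β := by ring

/-- **ORDER OBSTRUCTION vs BORDER READ-OUT, on the same systems.**  For every `k` and `β > ω` there
is a cheap correct family (all `n ≥ 1`) each of whose members is
(i) NOT pure-isolated and NOT initial-form nondegenerate to any order `K < 2^(k+1)` at ANY point of
the graph (M14a: its tests lie in `I^(2^k)`), yet (ii) lowest-form nondegenerate at `0`, hence
SERVED IN BORDER RANK: `bR(⟨n,n,n⟩) ≤ 2·cost` (M28, THEOREM D). -/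
theorem deep_family_obstructed_and_served (k : ℕ) {β : ℝ} (hβ : omega ℂ < β) :
    ∃ c : ℝ, ∀ n : ℕ, 1 ≤ n → ∃ E : EqSystem n, E.Correct ∧ (E.cost : ℝ) ≤ c * (n : ℝ) ^ β ∧
      (∀ K, K < 2 * 2 ^ k → ∀ x ∈ mmGraph n, ¬ E.PureIsolatedAt K x ∧ ¬ E.InitNondegAt K x) ∧
      E.LowInitNondegAt 0 ∧ algBorderRank (matMulTensor ℂ n n n) ≤ 2 * E.cost := by
  obtain ⟨c, hc⟩ := exists_deep_lowInitUnit_of_omega_lt k hβ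
  refine ⟨c, fun n hn => ?_⟩
  obtain ⟨E, hE, hdeep, hunit, hcost⟩ := hc n hn
  exact ⟨E, hE, hcost,
    fun K hK x hx => ⟨EqSystem.not_pureIsolatedAt_of_tests_mem_pow hn hK hdeep hx,
      EqSystem.not_initNondegAt_of_tests_mem_pow hn hK hdeep hx⟩,
    hunit.lowInitNondegAt, algBorderRank_le_of_lowInitNondegAt hE.1 hunit.lowInitNondegAt⟩

/-- In dial form: for every `k`, `EqAdmissibleLowInit β` is witnessed above `ω` by systems of depth
`2^k` (tests in `I^(2^k)`), although `EqAdmissibleInit β K` / `EqAdmissiblePure`-type witnesses of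
order `K < 2^(k+1)` cannot be found in the ideals of their tests (M14b
`exists_family_without_inIdeal_purification`). -/
theorem eqAdmissibleLowInit_deep_of_omega_lt (k : ℕ) {β : ℝ} (hβ : omega ℂ < β) :
    ∃ c : ℝ, ∀ n : ℕ, 1 ≤ n → ∃ E : EqSystem n, E.Correct ∧ E.LowInitNondeg ∧
      (∀ o : Fin E.tests.length, E.testPoly (E.tests.get o) ∈ graphIdeal n ^ 2 ^ k) ∧
      (E.cost : ℝ) ≤ c * (n : ℝ) ^ β := by
  obtain ⟨c, hc⟩ := exists_deep_lowInitUnit_of_omega_lt k hβ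
  refine ⟨c, fun n hn => ?_⟩
  obtain ⟨E, hE, hdeep, hunit, hcost⟩ := hc n hn
  exact ⟨E, hE, ⟨0, hunit.lowInitNondegAt⟩, hdeep, hcost⟩

end Summit.MatrixMultiplication.MatrixMultiplication.Theorems.GraphEquations
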